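import Summits.ResolutionOfSingularities.ResolutionOfSingularities.Theorems.HomologicalConductorNoZenoRLipman12B
import Literature.AlgebraicGeometry.Resolution.Lipman1969IntersectionTheoryRational
import HarnessLib

/-!
# Crux `NoZenoR` (stmt-ResolutionOfSingularities-19943) — consequences of `Lipman1969_1_2_B_holds`:
# every desingularization of a rational surface singularity has `H¹ = 0` (all universes), and the W3-bundle
# prints `Lipman1969_13_1_b_rat`, `Lipman1969_13_1_d_rat` (Lipman 1969, Prop. (13.1) b), d)) are THEOREMS

Route `ResolutionOfSingularities/HomologicalConductor` (cell decomp-res, hand leafhand-res-homologicalconduct-18 g0).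
OURS: AI-written bookkeeping over tree theorems, weaker than expert review; nothing here is a statement of the
manuscript under review (Hironaka 2017).  SUPPORT level, counted 0.  Def-free, no new named facts.

* `hasTrivialCechH1_of_isResolution_of_hasRationalSingularity` — Lipman (1.2) 2) for desingularizations, now
  UNCONDITIONAL at every universe: `R` a two-dimensional normal Noetherian local domain with a rational singularity,
  `π : X → Spec R` any resolution ⇒ `H¹(X, 𝒪_X) = 0` (`HasTrivialCechH1 π`).  (The tree's
  `Lipman1969_1_2_B.hasTrivialCechH1_of_isResolution` fed with `Lipman12B.Lipman1969_1_2_B_holds`.)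
* `Lipman1969_13_1_d_rat_holds`, `Lipman1969_13_1_b_rat_holds` — the named facts
  `Literature.AlgebraicGeometry.Resolution.Lipman1969_13_1_d_rat` / `…_b_rat` (hand 16 g0 proved them modulo
  Prop. (1.2): `Lipman1969_13_1_d_rat_of_1_2`, `…_b_rat_of_1_2`), now unconditional at every universe — the two
  short reductions re-run over the unconditional `H¹ = 0`.

No crux or summit statement is proved here.
-/

noncomputable section

-- single-problem summit: the doubled namespace component `ResolutionOfSingularities` is forced
set_option linter.dupNamespace false

open CategoryTheory AlgebraicGeometry TopologicalSpace IsLocalRing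
open Literature.AlgebraicGeometry.Resolution Literature.AlgebraicGeometry.Morphisms

universe u

namespace Summit.ResolutionOfSingularities.ResolutionOfSingularities.Theorems.NoZeno.Lipman12B

/-- **Every desingularization of a rational surface singularity has `H¹(X, 𝒪_X) = 0`** (Lipman 1969,
Prop. (1.2) 2) applied to a desingularization), UNCONDITIONAL: for `R` a normal Noetherian local domain of Krull
dimension `2` with `HasRationalSingularity R` and any resolution `π : X → Spec R`, `HasTrivialCechH1 π`.
[cite: Lipman1969, Proposition (1.2) 2) (p. 199) and its proof (p. 200)] -/
theorem hasTrivialCechH1_of_isResolution_of_hasRationalSingularity {R : Type u} [CommRing R]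
    [IsNoetherianRing R] [IsLocalRing R] [IsDomain R] [IsIntegrallyClosed R] (hdim : ringKrullDim R = 2)
    (hrat : HasRationalSingularity R) {X : Scheme.{u}} (π : X ⟶ Spec (.of R)) (hπ : IsResolution π) :
    HasTrivialCechH1 π :=
  Lipman1969_1_2_B_holds.{u}.hasTrivialCechH1_of_isResolution hdim hrat π hπ

/-- **Lipman 1969, Proposition (1.2) 2) in print generality — THEOREM**: `W` normal integral, `g : W → Spec R`
proper birational over a two-dimensional normal Noetherian local domain with a rational singularity ⇒
`H¹(W, 𝒪_W) = 0`. [cite: Lipman1969, Proposition (1.2) 2) (p. 199)] -/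
theorem hasTrivialCechH1_of_isProper_of_hasRationalSingularity {R : Type u} [CommRing R]
    [IsNoetherianRing R] [IsLocalRing R] [IsDomain R] [IsIntegrallyClosed R] (hdim : ringKrullDim R = 2)
    (hrat : HasRationalSingularity R) {W : Scheme.{u}} [IsIntegral W] (g : W ⟶ Spec (.of R)) [IsProper g]
    (hg : IsBirational g) (hWn : ∀ w : W, IsIntegrallyClosed (W.presheaf.stalk w)) :
    HasTrivialCechH1 g :=
  Lipman1969_1_2_B_holds.{u}.hasTrivialCechH1_of_isProper hdim hrat g hg hWn

/-- **`Lipman1969_13_1_d_rat` — THEOREM** (Lipman 1969, Prop. (13.1) d) in `h⁰`-lengths over a rational surface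
singularity: `(F·E_η) = h⁰(𝓘_η) + h⁰(𝓘_{η′}) − h⁰(𝓘_{η′}𝓘_η)` for all pairs of integral exceptional curves of a
desingularization).  Hand 16 g0's `excCurveDegree_primeDivisor_eq_h0` over the unconditional `H¹ = 0`.
[cite: Lipman1969, Proposition (13.1) d) (p. 223)] -/
theorem Lipman1969_13_1_d_rat_holds : Lipman1969_13_1_d_rat.{u} := by
  intro S _ _ _ _ _ hdim hrat X _ _ π hπ η hη η' hη' hF
  exact excCurveDegree_primeDivisor_eq_h0 π hdim hπ
    (hasTrivialCechH1_of_isResolution_of_hasRationalSingularity hdim hrat π hπ) hη hη' hF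

/-- **`Lipman1969_13_1_b_rat` — THEOREM** (Lipman 1969, Prop. (13.1) b): bi-additivity of the intersection number
of exceptional divisors in `h⁰`-lengths over a rational surface singularity).  Hand 16 g0's `h0_biadditivity`
over the unconditional `H¹ = 0`; body = `Lipman1969_13_1_b_rat_of_1_2` verbatim with the `H¹` input replaced.
[cite: Lipman1969, Proposition (13.1) b) and d) (p. 223)] -/
theorem Lipman1969_13_1_b_rat_holds : Lipman1969_13_1_b_rat.{u} := by
  intro S _ _ _ _ _ hdim hrat X π hπ s t u _ _ _ hs ht hu
  haveI : IsIntegral X := hπ.isIntegral_source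
  haveI : IsProper π := hπ.isProper
  haveI : IsLocallyNoetherian X := LocallyOfFiniteType.isLocallyNoetherian π
  have h1 := hasTrivialCechH1_of_isResolution_of_hasRationalSingularity hdim hrat π hπ
  have hprod : ∀ a b : Multiset X,
      ((a.map primeDivisorIdeal).prod * (b.map primeDivisorIdeal).prod : X.IdealSheafData) =
        ((a + b).map primeDivisorIdeal).prod := fun a b => by rw [Multiset.map_add, Multiset.prod_add]
  have key := h0_biadditivity π hdim hπ h1 s t u hs ht hu
  show ((h0 π (s.map primeDivisorIdeal).prod).toNat : ℤ) +
      ((h0 π ((t.map primeDivisorIdeal).prod * (u.map primeDivisorIdeal).prod)).toNat : ℤ) -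
      ((h0 π ((s.map primeDivisorIdeal).prod * (t.map primeDivisorIdeal).prod *
        (u.map primeDivisorIdeal).prod)).toNat : ℤ) =
    (((h0 π (s.map primeDivisorIdeal).prod).toNat : ℤ) + ((h0 π (t.map primeDivisorIdeal).prod).toNat : ℤ) -
        ((h0 π ((s.map primeDivisorIdeal).prod * (t.map primeDivisorIdeal).prod)).toNat : ℤ)) +
      (((h0 π (s.map primeDivisorIdeal).prod).toNat : ℤ) + ((h0 π (u.map primeDivisorIdeal).prod).toNat : ℤ) -
        ((h0 π ((s.map primeDivisorIdeal).prod * (u.map primeDivisorIdeal).prod)).toNat : ℤ))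
  rw [mul_assoc, hprod t u, hprod s (t + u), hprod s t, hprod s u]
  exact key

end Summit.ResolutionOfSingularities.ResolutionOfSingularities.Theorems.NoZeno.Lipman12B

end
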